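import Summits.QuantumFields.YangMills.Theorems.BalabanUVNodesN15KingModelPotentialEnvelope

/-!
# Route «BalabanUVNodes» (K4 «SpineRates»), node N15 = NE2 — THE KING-MODEL RUNG, part 9a: THE DRESSED LAPLACIAN IS LOCAL — NONPERTURBATIVELY.
# King's effective Laplacian in an ARBITRARY fine-lattice potential `Δ^{(k)}_w = a_k − a_k²N^dQ(A₀ + w)⁻¹Qᵀ`: uniform exponential locality and
# the block Combes–Thomas bound with the potential live, for every `w ≥ −w₀` (no smallness, no first-order truncation), uniformly in `k`, the volume, `m²`

Cell `pub-ymgap`, Track A (D-0062), seat `pub-ymgap-dag-n15-d` (R134 seat, strategy s3, gen 7).  `bears_on: R4∕N15`; `--supports` the K3‴ item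
`SpineGivenEndpointR13` (stmt-QuantumFields-19912).  COUNT-NEUTRAL.  Imports part 8d (`fineOpPot`, `effLaplacianPot`); the engine is the tree's
`Literature/…/King1986/UniformDecay` (Dimock 2013 App. D Lemmas 29–30 on the torus: `fineOp_coercive_unif`, `fineOp_coshRow_le`,
`abs_dot_inv_le_of_conj`), read with the potential LIVE.

WHY THIS FILE.  Parts 8a–8e dressed King's tower TO FIRST ORDER in a potential (`Δ^{(k)} + δΔ^{(k)}[v]`; 8d proved `δΔ^{(k)}[v] = potLevel`) and their
HONEST SCOPE left the FULL dressed operator `Δ^{(k)}_v` without letters («door (i): needs block-scale decay of the dressed minimiser — crux-sized»).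
Half of that door is open: the multiplication operator `diag(w)` has ZERO conjugation defect under the Combes–Thomas weights of `UniformDecay` and moves
the uniform coercivity `γ_A` of `A₀ = N²(−Δ) + m² + aQ*Q` (Lemma 29, the averaging operator's effective mass) by at most `w₀` when `w ≥ −w₀`; so
Dimock's block-to-block bound (Lemma 30) holds for `(A₀ + w)⁻¹` with the SAME rate, whence:
* §1 (generic, any symmetric coercive `S` on the fine torus with second-order conjugation defect `ρ`): **`abs_dot_inv_block_le`** — for `f`, `g`
  supported in the blocks `z`, `z′`, `|⟨f, S⁻¹g⟩| ≤ (γ − ρ)⁻¹e^{2κ}e^{−κ·tdist(z,z′)}‖f‖‖g‖ — and its block-NORM form **`blockNorm_inv_mulVec_le`**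
  (`‖1_{B(z)}·S⁻¹g‖ ≤ …`), the two workhorses of parts 9a–9c; `blkCut` is the block cut-off `1_{B(z)}·v`.
* §2 the dressed instances: `fineOpPot_symm`, **`fineOpPot_coercive_of_ge`** (`A₀ + w ≥ γ_A − w₀` for `w ≥ −w₀`), **`fineOpPot_coshRow_le`** (defect
  `(2d + a)κ²`, the SAME as `A₀`'s), `fineOpPot_isUnit`, `fineOpPot_sub_fineOpPot`, `fineOpPot_inv_symm`.
* §3 **`fineOpPot_inv_sandwich_le`** and **`effLaplacianPot_entry_le`**: `|Δ_eff(w)(b,b′)| ≤ (a + a²C)·e^{−κ·tdist(b,b′)}`,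
  `C = ctC = (γ_A − w₀ − (2d+a)κ²)⁻¹e^{2κ}` — King's (4.34)(ii) FOR THE DRESSED OPERATOR, every `w ≥ −w₀` with `w₀ + (2d+a)κ² < γ_A`, every `N`,
  every torus, every `m² ≥ 0`.
* Sequel (part 9b, `…KingModelPotentialLipschitz`): Lipschitz dependence on the potential WITH decay (the (3.35)-type locality letter of the FULL
  perturbation `Δ_eff(w) − Δ^{(k)}`, i.e. part 6b's `Reg335` slot DERIVED nonperturbatively) and the second-order Taylor remainder WITH decay; part 9c
  instantiates along King's run `N = L^k`, `a_k ∈ [a(1 − L⁻²), a]`.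

HONEST FRAMING ∕ LIMITS.  King's `A = 0` SCALAR block-spin construction (periodic b.c., flat blocks); the potential is a real multiplication operator on the
fine torus (NOT a gauge field; nothing here is Bałaban's `Δ^{(k)}(U) − Δ^{(k)}(1)`, `G(U)`, `C^{(k)}(Λ;U)` — η-differences NOT PRINTED); the TWO-SPACING
RATE letter (H3) of the full dressed tower is NOT proved here (it stays first-order, parts 8a∕8b: nonperturbatively it needs the `A = 0` instance of
King's Prop. 3.9 for the fine slice propagators, not in the tree); NOT a node discharge; typed 28∕28, discharged count untouched; one finite torus at
fixed ε — NOT ℝ⁴ ∕ infinite volume ∕ OS ∕ mass gap ∕ Clay.  Locators: [King1986] = C. King, CMP **102** (1986) 649–677, (2.13)–(2.14) p. 653, (4.34)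
p. 674 («Δ^{(k)} has uniform exponential decay (see Theorem 3.3)»); [Dimock2013] = J. Dimock, Rev. Math. Phys. **25** (2013) 1330010, App. D
Lemmas 29–30 (the averaging operator supplies an effective mass; conjugated-operator decay).
-/

noncomputable section

open scoped BigOperators Matrix
open Finset

namespace Summit.QuantumFields.YangMills.BalabanUVNodes.N15.KingModel

open Literature.MathematicalPhysics.QuantumFieldTheory.Balaban1983to89 hiding blockOf
open Literature.MathematicalPhysics.QuantumFieldTheory.Balaban1983to89.QGQInverse (Coercive isUnit_of_coercive)
open Literature.MathematicalPhysics.QuantumFieldTheory.Balaban1983to89.B5Prop11Plancherel (Tor fine)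
open Literature.MathematicalPhysics.QuantumFieldTheory.King1986 (abs_dot_inv_le_of_conj)
open Literature.MathematicalPhysics.QuantumFieldTheory.King1986.Torus

variable {d : ℕ}

/-! ## §1 Block-localised Combes–Thomas for a symmetric coercive operator on the fine torus (Dimock's Lemma 30, general supports) -/

section BlockCT

variable {N : ℕ} [NeZero N] {U : Fin (d + 1) → ℕ} [∀ μ, NeZero (U μ)]

/-- The BLOCK CUT-OFF `1_{B(z)}·v` of a fine-lattice vector: `v` on the `N`-block of the unit site `z`, `0` elsewhere. [folklore] -/
def blkCut (z : Tor U) (v : Tor (fine N U) → ℝ) : Tor (fine N U) → ℝ := fun x => if blockOf N U x = z then v x else 0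

/-- The block cut-off vanishes off its block. [folklore] -/
theorem blkCut_of_ne {z : Tor U} {v : Tor (fine N U) → ℝ} {x : Tor (fine N U)} (hx : blockOf N U x ≠ z) : blkCut z v x = 0 := by
  unfold blkCut; rw [if_neg hx]

/-- The squared norm of a block cut-off is the sum of squares over the block's `N^{d+1}` offsets. [folklore] -/
theorem blkCut_dot_self (z : Tor U) (v : Tor (fine N U) → ℝ) : blkCut z v ⬝ᵥ blkCut z v = ∑ j : Fin (d + 1) → Fin N, v (site N U z j) ^ 2 := by
  unfold dotProduct
  rw [sum_fine_eq_sum_blocks N U]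
  have h : ∀ z' : Tor U, ∑ j : Fin (d + 1) → Fin N, blkCut z v (site N U z' j) * blkCut z v (site N U z' j)
      = if z' = z then ∑ j : Fin (d + 1) → Fin N, v (site N U z' j) ^ 2 else 0 := by
    intro z'
    by_cases hz : z' = z
    · rw [if_pos hz]
      exact sum_congr rfl fun j _ => by unfold blkCut; rw [blockOf_site, if_pos hz, sq]
    · rw [if_neg hz]
      exact sum_eq_zero fun j _ => by unfold blkCut; rw [blockOf_site, if_neg hz, zero_mul]
  rw [sum_congr rfl fun z' _ => h z', sum_ite_eq' univ z, if_pos (mem_univ z)]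

/-- Cauchy–Schwarz with square roots: `|⟨u, v⟩| ≤ ‖u‖‖v‖`. [folklore] -/
theorem abs_dot_le_sqrt_mul_sqrt {ι : Type*} [Fintype ι] (u v : ι → ℝ) :
    |u ⬝ᵥ v| ≤ Real.sqrt (u ⬝ᵥ u) * Real.sqrt (v ⬝ᵥ v) := by
  have hcs : (u ⬝ᵥ v) ^ 2 ≤ (u ⬝ᵥ u) * (v ⬝ᵥ v) := B9Thm311.dot_sq_le u v
  have huu : 0 ≤ u ⬝ᵥ u := Literature.LinearAlgebra.Matrix.dotProduct_self_nonneg_real u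
  calc |u ⬝ᵥ v| = Real.sqrt ((u ⬝ᵥ v) ^ 2) := (Real.sqrt_sq_eq_abs _).symm
    _ ≤ Real.sqrt ((u ⬝ᵥ u) * (v ⬝ᵥ v)) := Real.sqrt_le_sqrt hcs
    _ = Real.sqrt (u ⬝ᵥ u) * Real.sqrt (v ⬝ᵥ v) := Real.sqrt_mul huu _

/-- LOWER weight bound: with the Combes–Thomas weight `f = (κ∕N)·tdist(·, x₀)` centred at the corner `x₀` of block `b`, every fine point of block
`z` has `f ≥ κ·tdist(z, b) − κ` (distinct blocks are far: `UniformDecay.mul_tdistT_blocks_le`). [folklore] -/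
theorem ctW_ge_of_blockOf {κ : ℝ} (hκ : 0 ≤ κ) (b z : Tor U) {x : Tor (fine N U)} (hx : blockOf N U x = z) :
    κ * tdistT U z b - κ ≤ ctW N U κ (site N U b (j0 N)) x := by
  have hNpos : (0 : ℝ) < N := by exact_mod_cast Nat.pos_of_ne_zero (NeZero.ne N)
  obtain ⟨j, hj⟩ := exists_eq_site N U x
  rw [hx] at hj
  rw [hj]
  show κ * tdistT U z b - κ ≤ κ / N * tdistT (fine N U) (site N U z j) (site N U b (j0 N))
  have hblk := mul_tdistT_blocks_le N U z b j (j0 N)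
  have h1 : κ / N * ((N : ℝ) * tdistT U z b - ((N : ℝ) - 1)) ≤ κ / N * tdistT (fine N U) (site N U z j) (site N U b (j0 N)) :=
    mul_le_mul_of_nonneg_left (by linarith) (by positivity)
  have h2 : κ / N * ((N : ℝ) * tdistT U z b - ((N : ℝ) - 1)) = κ * tdistT U z b - κ + κ / N := by field_simp; ring
  have h3 : 0 ≤ κ / N := by positivity
  linarith

/-- UPPER weight bound: on the block of its centre the weight is `≤ κ` (`UniformDecay.tdistT_site_site_le`). [folklore] -/
theorem ctW_le_of_blockOf {κ : ℝ} (hκ : 0 ≤ κ) (b : Tor U) {x : Tor (fine N U)} (hx : blockOf N U x = b) :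
    ctW N U κ (site N U b (j0 N)) x ≤ κ := by
  have hNpos : (0 : ℝ) < N := by exact_mod_cast Nat.pos_of_ne_zero (NeZero.ne N)
  obtain ⟨j, hj⟩ := exists_eq_site N U x
  rw [hx] at hj
  rw [hj]
  show κ / N * tdistT (fine N U) (site N U b j) (site N U b (j0 N)) ≤ κ
  calc κ / N * tdistT (fine N U) (site N U b j) (site N U b (j0 N)) ≤ κ / N * ((N : ℝ) - 1) :=
        mul_le_mul_of_nonneg_left (tdistT_site_site_le N U b j (j0 N)) (by positivity)
    _ = κ - κ / N := by field_simp
    _ ≤ κ := by linarith [div_nonneg hκ hNpos.le]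

/-- Weighted norm of a vector supported in block `z`, weight `e^{−f}` centred in block `b`: `‖e^{−f}v‖² ≤ e^{2κ}e^{−2κ·tdist(z,b)}‖v‖²`. [folklore] -/
theorem dot_expNeg_le {κ : ℝ} (hκ : 0 ≤ κ) (b z : Tor U) {v : Tor (fine N U) → ℝ} (hv : ∀ x, blockOf N U x ≠ z → v x = 0) :
    (fun x => Real.exp (-ctW N U κ (site N U b (j0 N)) x) * v x) ⬝ᵥ (fun x => Real.exp (-ctW N U κ (site N U b (j0 N)) x) * v x)
      ≤ Real.exp (2 * κ) * Real.exp (-(2 * κ * tdistT U z b)) * (v ⬝ᵥ v) := by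
  unfold dotProduct
  rw [mul_sum]
  refine sum_le_sum fun x _ => ?_
  by_cases hx : blockOf N U x = z
  · have hge := ctW_ge_of_blockOf (N := N) hκ b z hx
    have hexp : Real.exp (-ctW N U κ (site N U b (j0 N)) x) * Real.exp (-ctW N U κ (site N U b (j0 N)) x)
        ≤ Real.exp (2 * κ) * Real.exp (-(2 * κ * tdistT U z b)) := by
      rw [← Real.exp_add, ← Real.exp_add]
      exact Real.exp_le_exp.mpr (by linarith)
    calc Real.exp (-ctW N U κ (site N U b (j0 N)) x) * v x * (Real.exp (-ctW N U κ (site N U b (j0 N)) x) * v x)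
        = (Real.exp (-ctW N U κ (site N U b (j0 N)) x) * Real.exp (-ctW N U κ (site N U b (j0 N)) x)) * (v x * v x) := by ring
      _ ≤ (Real.exp (2 * κ) * Real.exp (-(2 * κ * tdistT U z b))) * (v x * v x) :=
          mul_le_mul_of_nonneg_right hexp (mul_self_nonneg _)
  · simp [hv x hx]

/-- Weighted norm of a vector supported in the centre block `b`, weight `e^{+f}`: `‖e^{f}v‖² ≤ e^{2κ}‖v‖²`. [folklore] -/
theorem dot_expPos_le {κ : ℝ} (hκ : 0 ≤ κ) (b : Tor U) {v : Tor (fine N U) → ℝ} (hv : ∀ x, blockOf N U x ≠ b → v x = 0) :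
    (fun x => Real.exp (ctW N U κ (site N U b (j0 N)) x) * v x) ⬝ᵥ (fun x => Real.exp (ctW N U κ (site N U b (j0 N)) x) * v x)
      ≤ Real.exp (2 * κ) * (v ⬝ᵥ v) := by
  unfold dotProduct
  rw [mul_sum]
  refine sum_le_sum fun x _ => ?_
  by_cases hx : blockOf N U x = b
  · have hle := ctW_le_of_blockOf (N := N) hκ b hx
    have hexp : Real.exp (ctW N U κ (site N U b (j0 N)) x) * Real.exp (ctW N U κ (site N U b (j0 N)) x) ≤ Real.exp (2 * κ) := by
      rw [← Real.exp_add]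
      exact Real.exp_le_exp.mpr (by linarith)
    calc Real.exp (ctW N U κ (site N U b (j0 N)) x) * v x * (Real.exp (ctW N U κ (site N U b (j0 N)) x) * v x)
        = (Real.exp (ctW N U κ (site N U b (j0 N)) x) * Real.exp (ctW N U κ (site N U b (j0 N)) x)) * (v x * v x) := by ring
      _ ≤ Real.exp (2 * κ) * (v x * v x) := mul_le_mul_of_nonneg_right hexp (mul_self_nonneg _)
  · simp [hv x hx]

/-- **DIMOCK'S LEMMA 30, BLOCK-TO-BLOCK, FOR A GENERAL SYMMETRIC COERCIVE OPERATOR ON THE FINE TORUS.**  `S` symmetric, `⟨ψ,Sψ⟩ ≥ γ‖ψ‖²`, and the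
`cosh`-weighted row sums of `S` for the weights `(κ∕N)·tdist(·, x₀)` at most `ρ < γ` for every centre `x₀`; then for `f` supported in block `z` and `g`
supported in block `z′`:  `|⟨f, S⁻¹g⟩| ≤ (γ − ρ)⁻¹·e^{2κ}·e^{−κ·tdist(z, z′)}·‖f‖·‖g‖` — *"|⟨f, G_k(Ω)f′⟩| ≤ O(1)e^{−δ₀d(y,y′)}‖f‖₂‖f′‖₂"*.
[cite: Dimock2013, App. D, Lemma 30 (usher1.5), arXiv:1108.1335v2] -/
theorem abs_dot_inv_block_le (S : Matrix (Tor (fine N U)) (Tor (fine N U)) ℝ) (hS : ∀ x y, S y x = S x y) {γ ρ κ : ℝ} (hρ0 : 0 ≤ ρ)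
    (hργ : ρ < γ) (hSc : Coercive S γ) (hκ : 0 ≤ κ)
    (hrow : ∀ x₀ x, ∑ x', |S x x'| * (Real.cosh (ctW N U κ x₀ x - ctW N U κ x₀ x') - 1) ≤ ρ)
    {z z' : Tor U} {f g : Tor (fine N U) → ℝ} (hf : ∀ x, blockOf N U x ≠ z → f x = 0) (hg : ∀ x, blockOf N U x ≠ z' → g x = 0) :
    |f ⬝ᵥ (S⁻¹ *ᵥ g)| ≤ (γ - ρ)⁻¹ * Real.exp (2 * κ) * Real.exp (-(κ * tdistT U z z')) * Real.sqrt (f ⬝ᵥ f) * Real.sqrt (g ⬝ᵥ g) := by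
  set x₀ : Tor (fine N U) := site N U z' (j0 N) with hx₀
  have h := abs_dot_inv_le_of_conj S hS (ctW N U κ x₀) hρ0 hργ hSc (hrow x₀) f g
  refine h.trans ?_
  have hff : 0 ≤ f ⬝ᵥ f := Literature.LinearAlgebra.Matrix.dotProduct_self_nonneg_real f
  have hgg : 0 ≤ g ⬝ᵥ g := Literature.LinearAlgebra.Matrix.dotProduct_self_nonneg_real g
  have hA : Real.sqrt ((fun x => Real.exp (-ctW N U κ x₀ x) * f x) ⬝ᵥ (fun x => Real.exp (-ctW N U κ x₀ x) * f x))
      ≤ Real.exp κ * Real.exp (-(κ * tdistT U z z')) * Real.sqrt (f ⬝ᵥ f) := by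
    have h1 := dot_expNeg_le (N := N) hκ z' z hf
    have e : Real.exp (2 * κ) * Real.exp (-(2 * κ * tdistT U z z')) = (Real.exp κ * Real.exp (-(κ * tdistT U z z'))) ^ 2 := by
      rw [← Real.exp_add, ← Real.exp_add, sq, ← Real.exp_add]; congr 1; ring
    rw [e] at h1
    calc Real.sqrt _ ≤ Real.sqrt ((Real.exp κ * Real.exp (-(κ * tdistT U z z'))) ^ 2 * (f ⬝ᵥ f)) := Real.sqrt_le_sqrt h1
      _ = Real.exp κ * Real.exp (-(κ * tdistT U z z')) * Real.sqrt (f ⬝ᵥ f) := by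
          rw [Real.sqrt_mul (sq_nonneg _), Real.sqrt_sq (by positivity)]
  have hB : Real.sqrt ((fun x => Real.exp (ctW N U κ x₀ x) * g x) ⬝ᵥ (fun x => Real.exp (ctW N U κ x₀ x) * g x))
      ≤ Real.exp κ * Real.sqrt (g ⬝ᵥ g) := by
    have h1 := dot_expPos_le (N := N) hκ z' hg
    have e : Real.exp (2 * κ) = (Real.exp κ) ^ 2 := by rw [sq, ← Real.exp_add]; congr 1; ring
    rw [e] at h1
    calc Real.sqrt _ ≤ Real.sqrt ((Real.exp κ) ^ 2 * (g ⬝ᵥ g)) := Real.sqrt_le_sqrt h1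
      _ = Real.exp κ * Real.sqrt (g ⬝ᵥ g) := by rw [Real.sqrt_mul (sq_nonneg _), Real.sqrt_sq (Real.exp_pos κ).le]
  have hγρ : 0 ≤ (γ - ρ)⁻¹ := inv_nonneg.mpr (by linarith)
  have e2 : Real.exp (2 * κ) = Real.exp κ * Real.exp κ := by rw [← Real.exp_add]; congr 1; ring
  calc (γ - ρ)⁻¹ * Real.sqrt ((fun x => Real.exp (-ctW N U κ x₀ x) * f x) ⬝ᵥ (fun x => Real.exp (-ctW N U κ x₀ x) * f x))
        * Real.sqrt ((fun x => Real.exp (ctW N U κ x₀ x) * g x) ⬝ᵥ (fun x => Real.exp (ctW N U κ x₀ x) * g x))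
      ≤ (γ - ρ)⁻¹ * (Real.exp κ * Real.exp (-(κ * tdistT U z z')) * Real.sqrt (f ⬝ᵥ f)) * (Real.exp κ * Real.sqrt (g ⬝ᵥ g)) := by
        gcongr
    _ = _ := by rw [e2]; ring

/-- **THE BLOCK NORM OF `S⁻¹g`** (`g` supported in block `z′`): `‖1_{B(z)}·S⁻¹g‖ ≤ (γ − ρ)⁻¹·e^{2κ}·e^{−κ·tdist(z,z′)}·‖g‖` — the operator-norm form of
Lemma 30 between blocks. [cite: Dimock2013, App. D, Lemma 30] -/
theorem blockNorm_inv_mulVec_le (S : Matrix (Tor (fine N U)) (Tor (fine N U)) ℝ) (hS : ∀ x y, S y x = S x y) {γ ρ κ : ℝ} (hρ0 : 0 ≤ ρ)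
    (hργ : ρ < γ) (hSc : Coercive S γ) (hκ : 0 ≤ κ)
    (hrow : ∀ x₀ x, ∑ x', |S x x'| * (Real.cosh (ctW N U κ x₀ x - ctW N U κ x₀ x') - 1) ≤ ρ)
    (z : Tor U) {z' : Tor U} {g : Tor (fine N U) → ℝ} (hg : ∀ x, blockOf N U x ≠ z' → g x = 0) :
    Real.sqrt (blkCut z (S⁻¹ *ᵥ g) ⬝ᵥ blkCut z (S⁻¹ *ᵥ g))
      ≤ (γ - ρ)⁻¹ * Real.exp (2 * κ) * Real.exp (-(κ * tdistT U z z')) * Real.sqrt (g ⬝ᵥ g) := by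
  set f := blkCut z (S⁻¹ *ᵥ g) with hfdef
  have hf : ∀ x, blockOf N U x ≠ z → f x = 0 := fun x hx => blkCut_of_ne hx
  have hfeq : f ⬝ᵥ (S⁻¹ *ᵥ g) = f ⬝ᵥ f := by
    unfold dotProduct
    refine sum_congr rfl fun x _ => ?_
    by_cases hx : blockOf N U x = z
    · rw [hfdef]; unfold blkCut; rw [if_pos hx]
    · rw [hf x hx, zero_mul, zero_mul]
  have h := abs_dot_inv_block_le S hS hρ0 hργ hSc hκ hrow hf hg
  rw [hfeq, abs_of_nonneg (Literature.LinearAlgebra.Matrix.dotProduct_self_nonneg_real f)] at h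
  set C := (γ - ρ)⁻¹ * Real.exp (2 * κ) * Real.exp (-(κ * tdistT U z z')) with hC
  have hC0 : 0 ≤ C := by rw [hC]; have : 0 ≤ (γ - ρ)⁻¹ := inv_nonneg.mpr (by linarith); positivity
  have hff : 0 ≤ f ⬝ᵥ f := Literature.LinearAlgebra.Matrix.dotProduct_self_nonneg_real f
  set s := Real.sqrt (f ⬝ᵥ f) with hs
  have hs0 : 0 ≤ s := Real.sqrt_nonneg _
  have hss : s * s = f ⬝ᵥ f := Real.mul_self_sqrt hff
  rcases hs0.eq_or_lt with hz | hpos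
  · rw [← hz]; have := Real.sqrt_nonneg (g ⬝ᵥ g); positivity
  · have h2 : s * s ≤ C * s * Real.sqrt (g ⬝ᵥ g) := by rw [hss]; exact h
    have h3 : s * s ≤ (C * Real.sqrt (g ⬝ᵥ g)) * s := by linarith [h2]
    exact le_of_mul_le_mul_right h3 hpos

end BlockCT

/-! ## §2 The dressed fine operator `A₀ + diag(w)`: symmetric, uniformly coercive, same conjugation defect -/

section Dressed

variable {N : ℕ} [NeZero N] {U : Fin (d + 1) → ℕ} [∀ μ, NeZero (U μ)] {a m2 : ℝ}

/-- The block Combes–Thomas CONSTANT of the dressed operator: `C = (γ_A − w₀ − (2d + a)κ²)⁻¹·e^{2κ}` (`γ_A = gamA`, Dimock's Lemma-29 constant). [folklore] -/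
def ctC (a w₀ κ : ℝ) (dd : ℕ) : ℝ := (gamA a dd - w₀ - (2 * dd + a) * κ ^ 2)⁻¹ * Real.exp (2 * κ)

/-- `C ≥ 0` under the gap. [folklore] -/
theorem ctC_nonneg {w₀ κ : ℝ} {dd : ℕ} (hgap : w₀ + (2 * dd + a) * κ ^ 2 < gamA a dd) : 0 ≤ ctC a w₀ κ dd := by
  unfold ctC; have : 0 ≤ (gamA a dd - w₀ - (2 * dd + a) * κ ^ 2)⁻¹ := inv_nonneg.mpr (by linarith); positivity

/-- `A₀ + diag(w)` is symmetric. [folklore] -/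
theorem fineOpPot_symm (c : ℝ) (w : Tor (fine N U) → ℝ) (x y : Tor (fine N U)) : fineOpPot N U a c m2 w y x = fineOpPot N U a c m2 w x y := by
  have h := congrFun (congrFun (fineOp_transpose N U a c m2) x) y
  rw [Matrix.transpose_apply] at h
  rw [fineOpPot, Matrix.add_apply, Matrix.add_apply, h]
  by_cases hxy : x = y
  · subst hxy; rfl
  · rw [Matrix.diagonal_apply_ne _ hxy, Matrix.diagonal_apply_ne _ (Ne.symm hxy)]

/-- **UNIFORM COERCIVITY OF THE DRESSED OPERATOR** (Dimock's Lemma 29 + the potential): for `w ≥ −w₀`, `⟨ψ, (A₀ + w)ψ⟩ ≥ (γ_A − w₀)‖ψ‖²`, `γ_A = gamA a d`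
independent of `N`, the torus and `m²`. [cite: Dimock2013, App. D, Lemma 29] -/
theorem fineOpPot_coercive_of_ge (ha : 0 ≤ a) (hm : 0 ≤ m2) {w : Tor (fine N U) → ℝ} {w₀ : ℝ} (hw : ∀ x, -w₀ ≤ w x) :
    Coercive (fineOpPot N U a ((N : ℝ) ^ 2) m2 w) (gamA a (d + 1) - w₀) := by
  intro ψ
  have hN1 : 1 ≤ N := Nat.one_le_iff_ne_zero.mpr (NeZero.ne N)
  have h0 := fineOp_coercive_unif N U hN1 ha hm ψ
  rw [fineOpPot, Matrix.add_mulVec, dotProduct_add]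
  have hdv : ψ ⬝ᵥ (Matrix.diagonal w *ᵥ ψ) = ∑ i, w i * (ψ i * ψ i) := by
    unfold dotProduct; exact sum_congr rfl fun i _ => by rw [Matrix.mulVec_diagonal]; ring
  have hψ : ψ ⬝ᵥ ψ = ∑ i, ψ i * ψ i := rfl
  have hd : -w₀ * (ψ ⬝ᵥ ψ) ≤ ψ ⬝ᵥ (Matrix.diagonal w *ᵥ ψ) := by
    rw [hdv, hψ, mul_sum]
    exact sum_le_sum fun i _ => mul_le_mul_of_nonneg_right (hw i) (mul_self_nonneg _)
  nlinarith

/-- **THE CONJUGATION DEFECT OF THE DRESSED OPERATOR IS `A₀`'s**: a diagonal carries the weight `cosh 0 − 1 = 0`, so for `0 ≤ κ ≤ 1` the `cosh`-weighted row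
sums of `A₀ + diag(w)` are `≤ (2d + a)κ²` exactly as `UniformDecay.fineOp_coshRow_le`. [cite: Dimock2013, App. D, proof of Lemma 30 (city1)] -/
theorem fineOpPot_coshRow_le (ha : 0 ≤ a) (hm : 0 ≤ m2) {κ : ℝ} (hκ0 : 0 ≤ κ) (hκ1 : κ ≤ 1) (w : Tor (fine N U) → ℝ) (x₀ x : Tor (fine N U)) :
    ∑ x', |fineOpPot N U a ((N : ℝ) ^ 2) m2 w x x'| * (Real.cosh (ctW N U κ x₀ x - ctW N U κ x₀ x') - 1)
      ≤ (2 * ((d + 1 : ℕ) : ℝ) + a) * κ ^ 2 := by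
  have h := fineOp_coshRow_le N U ha hm hκ0 hκ1 x₀ x
  refine le_trans (le_of_eq (sum_congr rfl fun x' _ => ?_)) h
  by_cases hx : x = x'
  · subst hx; rw [sub_self, Real.cosh_zero, sub_self, mul_zero, mul_zero]
  · rw [fineOpPot, Matrix.add_apply, Matrix.diagonal_apply_ne _ hx, add_zero]

/-- The dressed operator is invertible for `w ≥ −w₀`, `w₀ < γ_A`. [folklore] -/
theorem fineOpPot_isUnit (ha : 0 ≤ a) (hm : 0 ≤ m2) {w : Tor (fine N U) → ℝ} {w₀ : ℝ} (hw : ∀ x, -w₀ ≤ w x) (hw₀ : w₀ < gamA a (d + 1)) :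
    IsUnit (fineOpPot N U a ((N : ℝ) ^ 2) m2 w) :=
  isUnit_of_coercive (sub_pos.mpr hw₀) (fineOpPot_coercive_of_ge ha hm hw)

/-- §1 for the dressed operator, packaged: block bilinear bound with the constant `ctC`. [cite: Dimock2013, App. D, Lemma 30] -/
theorem dressed_block_le (ha : 0 ≤ a) (hm : 0 ≤ m2) {κ w₀ : ℝ} (hκ0 : 0 ≤ κ) (hκ1 : κ ≤ 1)
    (hgap : w₀ + (2 * ((d + 1 : ℕ) : ℝ) + a) * κ ^ 2 < gamA a (d + 1)) {w : Tor (fine N U) → ℝ} (hw : ∀ x, -w₀ ≤ w x)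
    {z z' : Tor U} {f g : Tor (fine N U) → ℝ} (hf : ∀ x, blockOf N U x ≠ z → f x = 0) (hg : ∀ x, blockOf N U x ≠ z' → g x = 0) :
    |f ⬝ᵥ ((fineOpPot N U a ((N : ℝ) ^ 2) m2 w)⁻¹ *ᵥ g)|
      ≤ ctC a w₀ κ (d + 1) * Real.exp (-(κ * tdistT U z z')) * Real.sqrt (f ⬝ᵥ f) * Real.sqrt (g ⬝ᵥ g) := by
  have h := abs_dot_inv_block_le (fineOpPot N U a ((N : ℝ) ^ 2) m2 w) (fineOpPot_symm _ w) (by positivity) (by linarith)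
    (fineOpPot_coercive_of_ge ha hm hw) hκ0 (fineOpPot_coshRow_le ha hm hκ0 hκ1 w) hf hg
  refine h.trans (le_of_eq ?_)
  unfold ctC; push_cast; ring

/-- §1's block-norm form for the dressed operator. [cite: Dimock2013, App. D, Lemma 30] -/
theorem dressed_blockNorm_le (ha : 0 ≤ a) (hm : 0 ≤ m2) {κ w₀ : ℝ} (hκ0 : 0 ≤ κ) (hκ1 : κ ≤ 1)
    (hgap : w₀ + (2 * ((d + 1 : ℕ) : ℝ) + a) * κ ^ 2 < gamA a (d + 1)) {w : Tor (fine N U) → ℝ} (hw : ∀ x, -w₀ ≤ w x)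
    (z : Tor U) {z' : Tor U} {g : Tor (fine N U) → ℝ} (hg : ∀ x, blockOf N U x ≠ z' → g x = 0) :
    Real.sqrt (blkCut z ((fineOpPot N U a ((N : ℝ) ^ 2) m2 w)⁻¹ *ᵥ g) ⬝ᵥ blkCut z ((fineOpPot N U a ((N : ℝ) ^ 2) m2 w)⁻¹ *ᵥ g))
      ≤ ctC a w₀ κ (d + 1) * Real.exp (-(κ * tdistT U z z')) * Real.sqrt (g ⬝ᵥ g) := by
  have h := blockNorm_inv_mulVec_le (fineOpPot N U a ((N : ℝ) ^ 2) m2 w) (fineOpPot_symm _ w) (by positivity) (by linarith)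
    (fineOpPot_coercive_of_ge ha hm hw) hκ0 (fineOpPot_coshRow_le ha hm hκ0 hκ1 w) z hg
  refine h.trans (le_of_eq ?_)
  unfold ctC; push_cast; ring

/-- `A₀ + diag(w′) − (A₀ + diag(w)) = diag(w′ − w)`. [folklore] -/
theorem fineOpPot_sub_fineOpPot (c : ℝ) (w w' : Tor (fine N U) → ℝ) :
    fineOpPot N U a c m2 w' - fineOpPot N U a c m2 w = Matrix.diagonal (w' - w) := by
  rw [fineOpPot, fineOpPot, add_sub_add_left_eq_sub, Matrix.diagonal_sub]; rfl

/-- The inverse of the dressed operator is symmetric. [folklore] -/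
theorem fineOpPot_inv_symm (c : ℝ) (w : Tor (fine N U) → ℝ) (x y : Tor (fine N U)) :
    (fineOpPot N U a c m2 w)⁻¹ y x = (fineOpPot N U a c m2 w)⁻¹ x y := by
  have hT : (fineOpPot N U a c m2 w)ᵀ = fineOpPot N U a c m2 w := by
    ext i j; rw [Matrix.transpose_apply]; exact fineOpPot_symm c w i j
  have hinv : ((fineOpPot N U a c m2 w)⁻¹)ᵀ = (fineOpPot N U a c m2 w)⁻¹ := by
    rw [Matrix.transpose_nonsing_inv, hT]
  have h := congrFun (congrFun hinv y) x
  rw [Matrix.transpose_apply] at h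
  exact h.symm

end Dressed

/-! ## §3 Locality of the dressed effective Laplacian `Δ_eff(w) = a − a²N^d·Q(A₀ + w)⁻¹Qᵀ`, uniformly -/

section Locality

variable {N : ℕ} [NeZero N] {U : Fin (d + 1) → ℕ} [∀ μ, NeZero (U μ)] {a m2 : ℝ}

/-- A block row of `Q` is supported in its block. [folklore] -/
theorem Qrow_eq_zero_of_ne (b : Tor U) {x : Tor (fine N U)} (hx : blockOf N U x ≠ b) : Qmat N U b x = 0 := by
  unfold Qmat; rw [if_neg hx]

/-- `‖Q_b‖² = N^{−(d+1)}` (`N^{d+1}` sites of weight `N^{−(d+1)}`). [folklore] -/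
theorem Qrow_dot_self (b : Tor U) : (fun x => Qmat N U b x) ⬝ᵥ (fun x => Qmat N U b x) = (((N : ℕ) : ℝ) ^ (d + 1))⁻¹ := by
  have h := Qrow_weighted_sq N U b (fun _ => (1 : ℝ))
  simp only [one_mul, one_pow, sum_const, card_univ, nsmul_eq_mul, mul_one] at h
  rw [h, card_offsets N]
  have hN : (((N : ℕ) : ℝ) ^ (d + 1)) ≠ 0 := pow_ne_zero _ (Nat.cast_ne_zero.mpr (NeZero.ne N))
  field_simp

/-- **LEMMA 30 FOR THE DRESSED PROPAGATOR, SANDWICHED**: `|(Q(A₀ + w)⁻¹Qᵀ)(b,b′)| ≤ C·N^{−(d+1)}·e^{−κ·tdist(b,b′)}` for every `w ≥ −w₀` under the gap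
`w₀ + (2d + a)κ² < γ_A` — uniformly in `N`, the torus and `m² ≥ 0`. [cite: Dimock2013, App. D, Lemma 30; King1986, (4.34) p.674] -/
theorem fineOpPot_inv_sandwich_le (ha : 0 ≤ a) (hm : 0 ≤ m2) {κ w₀ : ℝ} (hκ0 : 0 ≤ κ) (hκ1 : κ ≤ 1)
    (hgap : w₀ + (2 * ((d + 1 : ℕ) : ℝ) + a) * κ ^ 2 < gamA a (d + 1)) {w : Tor (fine N U) → ℝ} (hw : ∀ x, -w₀ ≤ w x) (b b' : Tor U) :
    |(Qmat N U * (fineOpPot N U a ((N : ℝ) ^ 2) m2 w)⁻¹ * (Qmat N U)ᵀ) b b'|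
      ≤ ctC a w₀ κ (d + 1) * (((N : ℕ) : ℝ) ^ (d + 1))⁻¹ * Real.exp (-(κ * tdistT U b b')) := by
  rw [sandwich_apply_eq_dot]
  have h := dressed_block_le ha hm hκ0 hκ1 hgap hw (fun x hx => Qrow_eq_zero_of_ne b hx) (fun x hx => Qrow_eq_zero_of_ne b' hx)
  refine h.trans (le_of_eq ?_)
  have hNd : (0 : ℝ) ≤ (((N : ℕ) : ℝ) ^ (d + 1))⁻¹ := by positivity
  rw [Qrow_dot_self, Qrow_dot_self, mul_assoc, Real.mul_self_sqrt hNd]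
  ring

/-- **KING'S (4.34)(ii) FOR THE DRESSED OPERATOR — THE EFFECTIVE LAPLACIAN IN A POTENTIAL IS EXPONENTIALLY LOCAL, UNIFORMLY**: for `a ≥ 0`, `m² ≥ 0`,
`0 ≤ κ ≤ 1`, `w₀ ≥ 0` with `w₀ + (2d + a)κ² < γ_A`, EVERY potential `w ≥ −w₀`, every `N = L^k`, every torus and all unit sites,
`|Δ_eff(w)(b, b′)| ≤ (a + a²·C)·e^{−κ·tdist(b, b′)}` (`C = ctC a w₀ κ d`).  No smallness of `w`, no first-order truncation.
[cite: King1986, (2.14) p.653, (4.34) p.674; Dimock2013, App. D, Lemmas 29–30 + (Cbound)] -/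
theorem effLaplacianPot_entry_le (ha : 0 ≤ a) (hm : 0 ≤ m2) {κ w₀ : ℝ} (hκ0 : 0 ≤ κ) (hκ1 : κ ≤ 1)
    (hgap : w₀ + (2 * ((d + 1 : ℕ) : ℝ) + a) * κ ^ 2 < gamA a (d + 1)) {w : Tor (fine N U) → ℝ} (hw : ∀ x, -w₀ ≤ w x) (b b' : Tor U) :
    |effLaplacianPot N U a ((N : ℝ) ^ 2) m2 w b b'| ≤ (a + a ^ 2 * ctC a w₀ κ (d + 1)) * Real.exp (-(κ * tdistT U b b')) := by
  have hN0 : (0 : ℝ) < ((N : ℕ) : ℝ) ^ (d + 1) := pow_pos (Nat.cast_pos.mpr (Nat.pos_of_ne_zero (NeZero.ne N))) _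
  have hsand := fineOpPot_inv_sandwich_le ha hm hκ0 hκ1 hgap hw b b'
  have hdiag : |a * (1 : Matrix (Tor U) (Tor U) ℝ) b b'| ≤ a * Real.exp (-(κ * tdistT U b b')) := by
    by_cases hb : b = b'
    · subst hb; rw [Matrix.one_apply_eq, tdistT_self, mul_zero, neg_zero, Real.exp_zero, abs_of_nonneg (by positivity)]
    · rw [Matrix.one_apply_ne hb, mul_zero, abs_zero]; positivity
  rw [effLaplacianPot, Matrix.sub_apply, Matrix.smul_apply, Matrix.smul_apply, smul_eq_mul, smul_eq_mul]
  calc |a * (1 : Matrix (Tor U) (Tor U) ℝ) b b' - a ^ 2 * (N : ℝ) ^ (d + 1) * (Qmat N U * (fineOpPot N U a ((N : ℝ) ^ 2) m2 w)⁻¹ * (Qmat N U)ᵀ) b b'|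
      ≤ |a * (1 : Matrix (Tor U) (Tor U) ℝ) b b'| + |a ^ 2 * (N : ℝ) ^ (d + 1) * (Qmat N U * (fineOpPot N U a ((N : ℝ) ^ 2) m2 w)⁻¹ * (Qmat N U)ᵀ) b b'| :=
        abs_sub _ _
    _ ≤ a * Real.exp (-(κ * tdistT U b b'))
        + a ^ 2 * (N : ℝ) ^ (d + 1) * (ctC a w₀ κ (d + 1) * (((N : ℕ) : ℝ) ^ (d + 1))⁻¹ * Real.exp (-(κ * tdistT U b b'))) := by
        refine add_le_add hdiag ?_
        rw [abs_mul, abs_of_nonneg (by positivity : (0 : ℝ) ≤ a ^ 2 * (N : ℝ) ^ (d + 1))]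
        exact mul_le_mul_of_nonneg_left hsand (by positivity)
    _ = _ := by field_simp

end Locality

end Summit.QuantumFields.YangMills.BalabanUVNodes.N15.KingModel

end
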